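import Literature.AnabelianGeometry.EtaleTheta.Discharge.Sec2HasMuLOfSetting
import Literature.AnabelianGeometry.EtaleTheta.ThetaCoversTemperedOfHuuOfSection
import Literature.AnabelianGeometry.EtaleTheta.ThetaCoversTemperedOfSection
import HarnessLib

/-!
# [EtTh] §2 at the §1 model: «`Π_C` acts trivially on `Δ̄_Θ`» (`HasMuL`) for the SECTION-ROUTE covers — the cusp-datum-free
# profinite statement behind abc-iut-L2-d3's `temperedCoverData_hasMuL`, and `HasMuL` for `temperedCoverDataOfHuuOfSection`
# (the R312 constructor of record) and `temperedCoverDataOfSection` (proof-only)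

S. Mochizuki, *The étale theta function and its Frobenioid-theoretic manifestations*, Publ. RIMS **45** (2009) [EtTh], §2: Rmk. 2.6.1
p. 40 («Suppose, for simplicity, that `K` contains a primitive `l`-th root of unity. Then …»), Cor. 2.9 p. 43, Def. 2.1 p. 35
(«`Δ̄_Θ ≅ (ℤ/lℤ)(1)`») [cite: MochizukiEtTh2009, Rmk 2.6.1 p.40]. Cell abc-iut, layer L2, seat abc-iut-L2-t10 (gen 6) — the section-cover
lineage (`coverDataAxOfSection`, p449075); companion of K10 v2/v3 (`HasMuL` at `κ′`). PROOF-ONLY (0 definitions).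

WHY. abc-iut-L2-t2's typed Rmk. 2.6.1 / Cor. 2.9 (`TemperedCoverData.Rmk261`, `Cor29_card`) carry print's «`μ_l ⊆ K`» as the antecedent
`T.HasMuL := ∀ c ∈ Π_C, ∀ t ∈ Δ̄_Θ-preimage, [c, t] ∈ Ker(Δ_X ↠ Δ̄_X)`. abc-iut-L2-d3's `temperedCoverData_hasMuL` (`Sec2HasMuLOfSetting`,
gen 5) derives it for the GEOMETRIC-cusp cover `e.temperedCoverData … hx hIx …` from «`Π^tp_X` acts trivially on `Δ_Θ / l·Δ_Θ`» (`hμ`).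
Its proof never touches the cusp datum: it is a statement about `I := e.piCDataOf ιC hιC` alone (`Π_C = PC`, `Δ̄_Θ`-preimage
`I.barTheta l`, kernel `I.barKer l`). THIS file records that profinite statement once (abc-iut-L2-d3's proof, re-keyed on `I`, attributed)
and feeds it to the two SECTION-route constructors, whose `toCoverDataAx` is this seat's `coverDataAxOfSection` with the SAME `PiC`,
`barTheta`, `barKer` (`rfl`) — so the R312 cover of record at the Kummer-carrying models also gets `HasMuL` from `hμ`:

* `CLevelData.commutator_mem_barKer_piCDataOf_of_trivial_action` — `∀ c : PC, ∀ t ∈ I.barTheta l, [c, t] ∈ I.barKer l` from `op`, P-C4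
  `hιell` and `hμ` (inside `Π_X`: abc-iut-L2-d3's `commutator_mem_barKerHat_of_trivial_action` along `incl`; outside: `c = c₁·y`, `c₁ ∈ Δ_C ∖ Π_X`
  acting trivially on `Δ̄_Θ` by `inv_theta_of_inv_ell`);
* **`CLevelData.temperedCoverDataOfHuuOfSection_hasMuL`** — `HasMuL` for abc-iut-L2-d3 g6's `temperedCoverDataOfHuuOfSection` (p452017, the
  constructor behind `exists_orbitEmbedding_inversionModelχ'`), modulo `hμ`;
* **`CLevelData.temperedCoverDataOfSection_hasMuL`** — the same for this seat's `temperedCoverDataOfSection` (p450512).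

CENSUS NOTE: at the untwisted `κ′` `hμ` holds for every `l` (K10 v2 `conj_commutator_mem_lDeltaTheta_inversionModelκ'`); at the χ-models the
action on `Δ_Θ` is the cyclotomic character (abc-iut-L2-d1's `conj_cThetaχ`), so `hμ` there is print's «`μ_l ⊆ K`» — its discharge for
`l ∣ p − 1` at `χ′` is NOT in this file (open; cf. K12 `hμK_modelχ'_iff_of_odd` for the field-theoretic side). HONEST LIMITS: semi-synthetic
models = consistency evidence only; nothing of [EtTh] asserted; no side taken on [IUTchIII] Cor. 3.12; typed ≠ proved.
-/

noncomputable section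

namespace Literature.AnabelianGeometry.EtaleTheta

open Literature.AnabelianGeometry.SemiGraphs ThetaCovers

namespace MuTwoSetting.CLevelData

variable {p : ℕ} [Fact p.Prime] {M : MuTwoSetting p}
variable {PC : Type} [Group PC] [TopologicalSpace PC] [IsTopologicalGroup PC] [T2Space PC]

/-- **The cusp-datum-free profinite statement** (abc-iut-L2-d3's `temperedCoverData_hasMuL` proof, re-keyed on `I := e.piCDataOf ιC hιC`):
if `Π^tp_X` acts trivially on `Δ_Θ / l·Δ_Θ`, then ALL of `Π_C = PC` acts trivially on `Δ̄_Θ` — `[c, t] ∈ I.barKer l` for every `c : PC` and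
`t` in the `Δ̄_Θ`-preimage `I.barTheta l` (inputs: the bundle `op`, P-C4 `hιell`, `hμ`). [cite: MochizukiEtTh2009, Rmk 2.6.1 p.40] -/
theorem commutator_mem_barKer_piCDataOf_of_trivial_action (e : M.CLevelData) (ιC : M.GtpC →ₜ* PC)
    (hιC : IsProfiniteCompletion ιC) (op : M.toThetaSetting.OncePuncturedData) {l : ℕ}
    (hιell : ∀ c ∈ (e.piCDataOf ιC hιC).augGK.ker, c ∉ (e.piCDataOf ιC hιC).PiX →
      ∀ d ∈ (e.piCDataOf ιC hιC).PiX ⊓ (e.piCDataOf ιC hιC).augGK.ker,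
        c * d * c⁻¹ * d ∈ (e.piCDataOf ιC hιC).barTheta l)
    (hμ : ∀ (σ : M.PiTemp) (a : M.GtpTheta), a ∈ M.DeltaTheta →
      M.toTheta σ * a * (M.toTheta σ)⁻¹ * a⁻¹ ∈ M.lDeltaTheta l) :
    ∀ c : PC, ∀ t ∈ (e.piCDataOf ιC hιC).barTheta l, c * t * c⁻¹ * t⁻¹ ∈ (e.piCDataOf ιC hιC).barKer l := by
  -- adapted from abc-iut-L2-d3's `temperedCoverData_hasMuL` (Sec2HasMuLOfSetting), cusp datum removed
  set I := e.piCDataOf ιC hιC with hI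
  haveI : (I.barTheta l).Normal := I.barTheta_normal l op
  -- inside `Π_X`
  have hX : ∀ c ∈ I.PiX, ∀ t ∈ I.barTheta l, c * t * c⁻¹ * t⁻¹ ∈ I.barKer l := by
    rintro _ ⟨ĉ, rfl⟩ t ht
    rw [I.barTheta_eq_map l op] at ht
    obtain ⟨t₀, ht₀, rfl⟩ := ht
    rw [I.barKer_eq_map l op]
    refine ⟨ĉ * t₀ * ĉ⁻¹ * t₀⁻¹,
      M.toThetaSetting.commutator_mem_barKerHat_of_trivial_action l hμ ĉ ht₀, ?_⟩
    rw [map_mul, map_mul, map_mul, map_inv, map_inv]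
  intro c t ht
  by_cases hc : c ∈ I.PiX
  · exact hX c hc t ht
  · -- `c = c₁ · y`, `c₁ ∈ Δ_C ∖ Π_X`, `y ∈ Π_X`
    obtain ⟨⟨y, hy⟩, hya⟩ := I.augGK_PiX_surjective (I.augGK c)
    have hya : I.augGK y = I.augGK c := hya
    have hc₁K : c * y⁻¹ ∈ I.augGK.ker := by
      rw [MonoidHom.mem_ker, map_mul, map_inv, hya, mul_inv_cancel]
    have hc₁X : c * y⁻¹ ∉ I.PiX := fun h => hc (by
      have := Subgroup.mul_mem _ h hy
      rwa [inv_mul_cancel_right] at this)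
    have ht' : y * t * y⁻¹ ∈ I.barTheta l := Subgroup.Normal.conj_mem inferInstance t ht y
    have h₁ := I.inv_theta_of_inv_ell l op hιell (c * y⁻¹) hc₁K hc₁X _ ht'
    have h₂ := hX y hy t ht
    have key : c * t * c⁻¹ * t⁻¹ =
        (c * y⁻¹ * (y * t * y⁻¹) * (c * y⁻¹)⁻¹ * (y * t * y⁻¹)⁻¹) * (y * t * y⁻¹ * t⁻¹) := by group
    rw [key]
    exact mul_mem h₁ h₂

/-- **`HasMuL` for abc-iut-L2-d3's R312 constructor of record `temperedCoverDataOfHuuOfSection`** (SECTION cusp datum; `Π_C = PC`,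
`Δ̄_Θ`-preimage `I.barTheta l`, kernel `I.barKer l` by `rfl`), modulo «`Π^tp_X` acts trivially on `Δ_Θ / l·Δ_Θ`» (`hμ`).
[cite: MochizukiEtTh2009, Rmk 2.6.1 p.40] -/
theorem temperedCoverDataOfHuuOfSection_hasMuL (e : M.CLevelData) (ιC : M.GtpC →ₜ* PC) (hιC : IsProfiniteCompletion ιC)
    (hinj : Function.Injective ιC) (op : M.toThetaSetting.OncePuncturedData) {l : ℕ} (hodd : Odd l)
    (s : ↥M.GK →* M.PiTemp) (hsa : ∀ σ, M.aug (s σ) = (σ : GQp p)) (hsZ : ∀ σ, M.toZ (s σ) = 1)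
    (hιell : ∀ c ∈ (e.piCDataOf ιC hιC).augGK.ker, c ∉ (e.piCDataOf ιC hιC).PiX →
      ∀ d ∈ (e.piCDataOf ιC hιC).PiX ⊓ (e.piCDataOf ιC hιC).augGK.ker,
        c * d * c⁻¹ * d ∈ (e.piCDataOf ιC hιC).barTheta l)
    (hN : ((M.GtpXu l).map M.inclX).Normal) (hY : (M.GtpY.map M.inclX).Normal)
    {E : M.toThetaSetting.EtaleThetaData} (C : E.DoubleUnderline l) (hK : M.barKerTp l ≤ C.Huu)
    (hsH : ∀ σ, s σ ∈ C.Huu) {g : M.GtpC} (hgX : g ∉ M.inclX.range) (hι : C.IotaStable (e.conjX g))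
    (hμ : ∀ (σ : M.PiTemp) (a : M.GtpTheta), a ∈ M.DeltaTheta →
      M.toTheta σ * a * (M.toTheta σ)⁻¹ * a⁻¹ ∈ M.lDeltaTheta l) :
    (e.temperedCoverDataOfHuuOfSection ιC hιC hinj op hodd s hsa hsZ hιell hN hY C hK hsH hgX hι).HasMuL := by
  show ∀ c : PC, ∀ t ∈ (e.piCDataOf ιC hιC).barTheta l, c * t * c⁻¹ * t⁻¹ ∈ (e.piCDataOf ιC hιC).barKer l
  exact e.commutator_mem_barKer_piCDataOf_of_trivial_action ιC hιC op hιell hμ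

/-- **`HasMuL` for this seat's `temperedCoverDataOfSection`** (the un-pinned section-route assembly, p450512), modulo `hμ`.
[cite: MochizukiEtTh2009, Rmk 2.6.1 p.40] -/
theorem temperedCoverDataOfSection_hasMuL (e : M.CLevelData) (ιC : M.GtpC →ₜ* PC) (hιC : IsProfiniteCompletion ιC)
    (hinj : Function.Injective ιC) (op : M.toThetaSetting.OncePuncturedData) {l : ℕ} (hodd : Odd l)
    (s : ↥M.GK →* M.PiTemp) (hsa : ∀ σ, M.aug (s σ) = (σ : GQp p)) (hsZ : ∀ σ, M.toZ (s σ) = 1) (hsc : Continuous s)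
    (hιell : ∀ c ∈ (e.piCDataOf ιC hιC).augGK.ker, c ∉ (e.piCDataOf ιC hιC).PiX →
      ∀ d ∈ (e.piCDataOf ιC hιC).PiX ⊓ (e.piCDataOf ιC hιC).augGK.ker,
        c * d * c⁻¹ * d ∈ (e.piCDataOf ιC hιC).barTheta l)
    (hN : ((M.GtpXu l).map M.inclX).Normal) (hY : (M.GtpY.map M.inclX).Normal)
    (hμ : ∀ (σ : M.PiTemp) (a : M.GtpTheta), a ∈ M.DeltaTheta →
      M.toTheta σ * a * (M.toTheta σ)⁻¹ * a⁻¹ ∈ M.lDeltaTheta l) :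
    (e.temperedCoverDataOfSection ιC hιC hinj op hodd s hsa hsZ hsc hιell hN hY).HasMuL := by
  show ∀ c : PC, ∀ t ∈ (e.piCDataOf ιC hιC).barTheta l, c * t * c⁻¹ * t⁻¹ ∈ (e.piCDataOf ιC hιC).barKer l
  exact e.commutator_mem_barKer_piCDataOf_of_trivial_action ιC hιC op hιell hμ

end MuTwoSetting.CLevelData

end Literature.AnabelianGeometry.EtaleTheta

end
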